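import Literature.IUT.HodgeTheaters.GenuineFKitMergeInputsLiftsGammaInner
import HarnessLib

/-!
# [IUTchI] Cor 5.3 (ii), surjectivity half AT THE MERGE TERM: every Γ-inner transporter of the kit's `Π_v̲` lifts to the genuine `𝒞_v̲`
# (the `n`-clause of `goodLiftsAllAt_iff` ★ p501097; companion of `GenuineFKitMergeInputsLiftsGammaInner.lean`, racer B FILE 7)

S. Mochizuki, *Inter-universal Teichmüller theory I*, kurims manuscript (May 2020), §5 Corollary 5.3 (ii) p. 144 and the argument printed for (iv),
p. 144 l. 41–43 («surjectivity follows immediately from the construction of `ℱ̲_v`»); Def 3.1 (e)(f) pp. 62–63 ([IUTchI] Cor 5.3 (ii) p.144)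
[claim: Mochizuki2012, status: disputed] (D-0012 claim key; PROOF-ONLY over landed files; nothing of the series is asserted; no side is taken on
[IUTchIII] Cor. 3.12).  Also [cite: MochizukiFrdII2008, Ex 1.3 (ii) p.11] (transport functors `pull`, composed ON THE NOSE by abc-iut-w4-d058 `pull_comp`).

WHAT IS PROVED.  `InitialThetaData.exists_selfEquivalence_liesUnder_of_gammaInner` (generic place data `p k ι hinj hX`, seam `hG`) and
`exists_selfEquivalence_liesUnder_of_gammaInner_at` (racer C's `frobeniusGoodAt CG hA B I x hx`, good nonarchimedean `x`): for every transporter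
`n ∈ N_{Π_{C_F}}(Π_v̲)` with `augGF n` in the image of `Gal(K̄_v̲/K_v̲) → G_F` there is a self-equivalence `Ψ` of the genuine `𝒞_v̲` lying under
`E ∘ conj_n ∘ E⁻¹` through `toBase` — EXACTLY the `n`-clause of the right-hand side of `goodLiftsAllAt_iff` (★ p501097).  Proof: `n⁻¹` read on
`Π_{X̲→_K} ×_{G_F} Gal` (`transporterEnd`, §C) is Γ-inner (`augLoc_transporterEnd`), §B (`GammaInnerLift.exists_selfEquivalence_liesUnder_pullSelfEquiv`) lifts
it, and the five `pull`s of `E ∘ conj_n ∘ E⁻¹` compose on the nose to `pull (transporterEnd n⁻¹)`.  RESIDUAL (honest): the NON-Γ-inner transporters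
(`Gal(K_v̲/F_v)`-part; semilinear action on `K̄_v̲`, number theory not in tree) and `RigidOverBase` (rigidity rows) — `LiftsAll`/Cor 5.3 (ii) are NOT
claimed.  Binders: the kit's ∪ {I, x, hx, hxb} ∪ {n, hn}; 0 def · 0 instance · 0 notation; typed ≠ proved beyond what is here.
-/

noncomputable section

namespace Literature.IUT.HodgeTheaters

open CategoryTheory Opposite Literature.AnabelianGeometry.SemiGraphs Literature.AlgebraicGeometry.Frobenioids

namespace InitialThetaData

/-! ### §D. AT THE MERGE TERM: every Γ-INNER transporter of `Π_v̲` lifts to the genuine `𝒞_v̲` (the `goodLiftsAllAt_iff` clause for it) -/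

section AtTerm

universe uF vK

/-- A left inverse makes a homomorphism surjective. [folklore] -/
private theorem surj_of_comp_eq_id {P Q : Type} [Group P] [Group Q] {φ : P →* Q} {ψ : Q →* P}
    (h : φ.comp ψ = MonoidHom.id Q) : Function.Surjective φ :=
  fun x => ⟨ψ x, DFunLike.congr_fun h x⟩

variable {F K Fbar : Type} [Field F] [NumberField F] [Field K] [NumberField K] [Algebra F K]
  [Field Fbar] [Algebra F Fbar] [Algebra K Fbar]
  {E : WeierstrassCurve F} [E.IsElliptic] {l : ℕ} {Pb : BadPlacePredicates K}
  (D : InitialThetaData F K Fbar E l Pb) (CG : D.geom.pe.CuspGalois) (hS : D.CuspClassesNormaliserStable) [Fact l.Prime]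
  (M : D.TorsionMonodromy) (hA : D.geom.pe.ArrowCoveringClaims)
  (hI : ∀ k ∈ D.geom.pe.inertia D.geom.pe.ε1, M.tau (D.geom.embK k) = 0)
  (B : ∀ v, v ∈ D.indexCopyBad → D.BadPairAt v) (ΛBad : ∀ v (h : v ∈ D.indexCopyBad), D.LocalArrowLaw CG hS (B v h).H)
  (p : ℕ) [Fact p.Prime] (k : Type) [NontriviallyNormedField k] [CompleteSpace k] [IsUltrametricDist k]
  [NormedAlgebra ℚ_[p] k] [FiniteDimensional ℚ_[p] k] [Algebra K k] (ι : Fbar →ₐ[K] AlgebraicClosure k)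
  [IsScalarTower F K Fbar] [Normal K Fbar]
  (hinj : Function.Injective (localToGF F k ι)) (hX : IsOpen (D.PiXarrow : Set D.PiC)) (x : D.IndexCopy)
  (hG : (D.localDataOfBadPairs CG hS M hA hI B ΛBad x).H = D.PiXarrow ⊓ (localToGF F k ι).range.comap D.augGF)

include hinj hX hG in
/-- **THE Γ-INNER TRANSPORTERS LIFT (generic place data).**  At the (S1) slot of record over `D.goodLocalFrobenioidOfEmb p k ι hX`, every transporter
`n ∈ N_{Π_{C_F}}(Π_v̲)` whose image `augGF n` lies in the image of `Gal(k̄/k) → G_F` has a self-equivalence of the genuine `𝒞_v̲` lying under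
`E ∘ conj_n ∘ E⁻¹` through `toBase` (`E = goodBaseEquiv`) — the clause of `goodLift_model_case_iff`'s `LiftsAll` for `n`, PROVED: the transport of
`n` to `Π_{X̲→_K} ×_{G_F} Gal(k̄/k)` (§C) is Γ-inner, §B lifts it, and the five transport functors of `E ∘ conj_n ∘ E⁻¹` compose ON THE NOSE to
`pull` of that transport (abc-iut-w4-d058 `pull_comp`). ([IUTchI] Cor 5.3 (ii) p.144) [claim: Mochizuki2012, status: disputed] -/
theorem exists_selfEquivalence_liesUnder_of_gammaInner
    (n : ↥(Subgroup.normalizer (((D.localDataOfBadPairs CG hS M hA hI B ΛBad x).H : Subgroup D.PiC) : Set D.PiC)))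
    (hn : D.augGF (n : D.PiC) ∈ (localToGF F k ι).range) :
    letI := GaloisValDatum.normVal k
    ∃ Ψ : (D.goodLocalFrobenioidOfEmb p k ι hX).Cv ≌ (D.goodLocalFrobenioidOfEmb p k ι hX).Cv,
      Nonempty (CatIsomorphism.LiesUnder (D.goodLocalFrobenioidOfEmb p k ι hX).toBase (D.goodLocalFrobenioidOfEmb p k ι hX).toBase Ψ
        (((D.goodBaseEquiv CG hS M hA hI B ΛBad p k ι hinj hX x hG).trans (PiTransport.conjSelfEquiv _ n)).trans
          (D.goodBaseEquiv CG hS M hA hI B ΛBad p k ι hinj hX x hG).symm)) := by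
  letI := GaloisValDatum.normVal k
  haveI := Literature.IUT.HodgeTheaters.compactSpace_gal_algebraicClosure p k
  have hn' : ((n⁻¹ : ↥(Subgroup.normalizer (((D.localDataOfBadPairs CG hS M hA hI B ΛBad x).H : Subgroup D.PiC) : Set D.PiC))) : D.PiC) ∈
      Subgroup.normalizer (((D.PiXarrow ⊓ (localToGF F k ι).range.comap D.augGF : Subgroup D.PiC)) : Set D.PiC) := by
    rw [← hG]
    exact (n⁻¹).2
  let m : ↥(Subgroup.normalizer (((D.PiXarrow ⊓ (localToGF F k ι).range.comap D.augGF : Subgroup D.PiC)) : Set D.PiC)) := ⟨_, hn'⟩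
  obtain ⟨γ₀, hγ₀⟩ := hn
  have hγm : D.augGF (m : D.PiC) = localToGF F k ι γ₀⁻¹ := by
    change D.augGF ((n : D.PiC)⁻¹) = _
    rw [map_inv, map_inv, hγ₀]
  -- the Γ-inner automorphism of `Π_{X̲→_K} ×_{G_F} Gal(k̄/k)` and its inverse
  let φ := D.transporterEnd D.PiXarrow (localToGF F k ι) hinj m
  let ψ := D.transporterEnd D.PiXarrow (localToGF F k ι) hinj m⁻¹
  have hφc : Continuous φ := D.continuous_transporterEnd D.PiXarrow (localToGF F k ι) hinj hX (continuous_localToGF F k ι) m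
  have hψc : Continuous ψ := D.continuous_transporterEnd D.PiXarrow (localToGF F k ι) hinj hX (continuous_localToGF F k ι) m⁻¹
  have h₁ : φ.comp ψ = MonoidHom.id _ := D.transporterEnd_comp_inv D.PiXarrow (localToGF F k ι) hinj m
  have h₂ : ψ.comp φ = MonoidHom.id _ := D.transporterEnd_inv_comp D.PiXarrow (localToGF F k ι) hinj m
  have hγ : ∀ z, D.augLoc D.PiXarrow (localToGF F k ι) (φ z) = γ₀⁻¹ * D.augLoc D.PiXarrow (localToGF F k ι) z * γ₀⁻¹⁻¹ :=
    fun z => D.augLoc_transporterEnd D.PiXarrow (localToGF F k ι) hinj m γ₀⁻¹ hγm z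
  -- §B: the lift over `pullSelfEquiv φ ψ`
  obtain ⟨Ψ, ⟨i⟩⟩ := GammaInnerLift.exists_selfEquivalence_liesUnder_pullSelfEquiv (GaloisValDatum.ofComplete p k)
    (D.augLoc D.PiXarrow (localToGF F k ι)) (D.continuous_augLoc D.PiXarrow (localToGF F k ι))
    (D.augLoc_PiXarrow_surjective k ι) (D.isOpenMap_augLoc D.PiXarrow (localToGF F k ι) hX (continuous_localToGF F k ι)) k
    (GaloisValDatum.p_mem_normVal p k) φ hφc (surj_of_comp_eq_id h₁) γ₀⁻¹ hγ ψ hψc h₁ h₂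
  refine ⟨Ψ, ⟨?_⟩⟩
  -- the five transport functors of `E ∘ conj_n ∘ E⁻¹` and their composite ON THE NOSE
  let Hx : Subgroup D.PiC := (D.localDataOfBadPairs CG hS M hA hI B ΛBad x).H
  let H' : Subgroup D.PiC := D.PiXarrow ⊓ (localToGF F k ι).range.comap D.augGF
  let e := D.piLocEquiv D.PiXarrow (localToGF F k ι) hinj
  let a₁ : ↥H' →* ↥(D.PiLoc D.PiXarrow (localToGF F k ι)) := e.symm.toMonoidHom
  let a₂ : ↥Hx →* ↥H' := Subgroup.inclusion (le_of_eq hG)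
  let c : ↥Hx →* ↥Hx := PiTransport.conjSub Hx n⁻¹
  let b₁ : ↥H' →* ↥Hx := Subgroup.inclusion (le_of_eq hG.symm)
  let b₂ : ↥(D.PiLoc D.PiXarrow (localToGF F k ι)) →* ↥H' := e.toMonoidHom
  have ha₁c : Continuous a₁ := D.continuous_piLocEquiv_symm D.PiXarrow (localToGF F k ι) hX (continuous_localToGF F k ι) hinj
  have ha₁s : Function.Surjective a₁ := e.symm.surjective
  have ha₂c : Continuous a₂ := Continuous.subtype_mk continuous_subtype_val _
  have ha₂s : Function.Surjective a₂ := fun y =>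
    ⟨⟨y.1, by change (y : D.PiC) ∈ (D.localDataOfBadPairs CG hS M hA hI B ΛBad x).H; rw [hG]; exact y.2⟩, rfl⟩
  have hcc : Continuous c := PiTransport.continuous_conjSub _ _
  have hcs : Function.Surjective c := surj_of_comp_eq_id (PiTransport.conjSub_comp_inv Hx n⁻¹)
  have hb₁c : Continuous b₁ := Continuous.subtype_mk continuous_subtype_val _
  have hb₁s : Function.Surjective b₁ := fun y =>
    ⟨⟨y.1, by change (y : D.PiC) ∈ D.PiXarrow ⊓ (localToGF F k ι).range.comap D.augGF; rw [← hG]; exact y.2⟩, rfl⟩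
  have hb₂c : Continuous b₂ := D.continuous_piLocEquiv D.PiXarrow (localToGF F k ι) hinj
  have hb₂s : Function.Surjective b₂ := e.surjective
  have h12c : Continuous (a₁.comp a₂) := ha₁c.comp ha₂c
  have h12s : Function.Surjective (a₁.comp a₂) := ha₁s.comp ha₂s
  have h123c : Continuous ((a₁.comp a₂).comp c) := h12c.comp hcc
  have h123s : Function.Surjective ((a₁.comp a₂).comp c) := h12s.comp hcs
  have h45c : Continuous (b₁.comp b₂) := hb₁c.comp hb₂c
  have h45s : Function.Surjective (b₁.comp b₂) := hb₁s.comp hb₂s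
  have hallc : Continuous ((((a₁.comp a₂).comp c)).comp (b₁.comp b₂)) := h123c.comp h45c
  have halls : Function.Surjective ((((a₁.comp a₂).comp c)).comp (b₁.comp b₂)) := h123s.comp h45s
  have key : (((D.goodBaseEquiv CG hS M hA hI B ΛBad p k ι hinj hX x hG).trans (PiTransport.conjSelfEquiv _ n)).trans
      (D.goodBaseEquiv CG hS M hA hI B ΛBad p k ι hinj hX x hG).symm).functor = (PiTransport.pullSelfEquiv φ ψ hφc hψc h₁ h₂).functor := by
    change ((CosetCat.pull a₁ ha₁c ha₁s ⋙ CosetCat.pull a₂ ha₂c ha₂s) ⋙ CosetCat.pull c hcc hcs) ⋙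
      (CosetCat.pull b₁ hb₁c hb₁s ⋙ CosetCat.pull b₂ hb₂c hb₂s) = CosetCat.pull φ hφc (surj_of_comp_eq_id h₁)
    rw [CosetCat.pull_comp a₁ ha₁c ha₁s a₂ ha₂c ha₂s h12c h12s, CosetCat.pull_comp (a₁.comp a₂) h12c h12s c hcc hcs h123c h123s,
      CosetCat.pull_comp b₁ hb₁c hb₁s b₂ hb₂c hb₂s h45c h45s,
      CosetCat.pull_comp ((a₁.comp a₂).comp c) h123c h123s (b₁.comp b₂) h45c h45s hallc halls]
    refine CosetCat.pull_congr _ _ _ _ _ _ (MonoidHom.ext fun z => ?_)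
    change e.symm (a₂ (c (b₁ (e z)))) = e.symm (PiTransport.conjSub _ m (e z))
    congr 1
  exact i ≪≫ eqToIso (congrArg (fun G => (D.goodLocalFrobenioidOfEmb p k ι hX).toBase ⋙ G) key.symm)

variable (I : D.MergeInputs B) (hx : x ∉ D.indexCopyArc) (hxb : x ∉ D.indexCopyBad) [Fact (D.primeAt x hx).Prime]

omit [IsScalarTower F K Fbar] [Normal K Fbar] in
include hxb in
/-- **THE Γ-INNER TRANSPORTERS LIFT AT THE MERGE TERM** (racer C's `frobeniusGoodAt CG hA B I x hx`, good nonarchimedean `x`): every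
`n ∈ N_{Π_{C_F}}(Π_v̲)` with `augGF n` in the image of `Gal(K̄_v̲/K_v̲) → G_F` satisfies the `n`-clause of `goodLiftsAllAt_iff` (★ p501097) — so the
OPEN surjectivity half `LiftsAll` of the Cor 5.3 (ii) good-place reading is REDUCED to the non-Γ-inner transporters (the `Gal(K_v̲/F_v)`-part:
semilinear Galois action on `K̄_v̲`, number theory not in the tree). ([IUTchI] Cor 5.3 (ii) p.144) [claim: Mochizuki2012, status: disputed] -/
theorem exists_selfEquivalence_liesUnder_of_gammaInner_at
    (n : ↥(Subgroup.normalizer (((D.localDataOfBadPairs CG hS M hA hI B ΛBad x).H : Subgroup D.PiC) : Set D.PiC)))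
    (hn : haveI := D.isScalarTower
      haveI := D.normal_K
      letI := D.algebraKvAt x hx
      D.augGF (n : D.PiC) ∈ (localToGF F (D.KvAt x hx) (localEmb (K := K) (Fbar := Fbar) (AlgebraicClosure (D.KvAt x hx)))).range) :
    letI := GaloisValDatum.normVal (D.KvAt x hx)
    ∃ Ψ : (D.frobeniusGoodAt CG hA B I x hx).Cv ≌ (D.frobeniusGoodAt CG hA B I x hx).Cv,
      Nonempty (CatIsomorphism.LiesUnder (D.frobeniusGoodAt CG hA B I x hx).toBase (D.frobeniusGoodAt CG hA B I x hx).toBase Ψ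
        (haveI := D.isScalarTower
         haveI := D.normal_K
         letI := D.algebraKvAt x hx
         haveI := GaloisValDatum.finiteDimensional_rescaledCompletion K (D.primeAt x hx) (D.specAt x hx) (D.primeAt_mem x hx)
         ((D.goodBaseEquiv CG hS M hA hI B ΛBad (D.primeAt x hx) (D.KvAt x hx)
            (localEmb (K := K) (Fbar := Fbar) (AlgebraicClosure (D.KvAt x hx))) (D.localToGF_injective_at x hx)
            (D.isOpen_PiXarrow_of_mergeInputs CG hA B I) x (D.localDataOfBadPairs_H_at CG hS M hA hI B ΛBad x hx hxb)).trans
          (PiTransport.conjSelfEquiv _ n)).trans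
         (D.goodBaseEquiv CG hS M hA hI B ΛBad (D.primeAt x hx) (D.KvAt x hx)
            (localEmb (K := K) (Fbar := Fbar) (AlgebraicClosure (D.KvAt x hx))) (D.localToGF_injective_at x hx)
            (D.isOpen_PiXarrow_of_mergeInputs CG hA B I) x (D.localDataOfBadPairs_H_at CG hS M hA hI B ΛBad x hx hxb)).symm)) := by
  haveI := D.isScalarTower
  haveI := D.normal_K
  letI := D.algebraKvAt x hx
  haveI := GaloisValDatum.finiteDimensional_rescaledCompletion K (D.primeAt x hx) (D.specAt x hx) (D.primeAt_mem x hx)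
  exact D.exists_selfEquivalence_liesUnder_of_gammaInner CG hS M hA hI B ΛBad (D.primeAt x hx) (D.KvAt x hx)
    (localEmb (K := K) (Fbar := Fbar) (AlgebraicClosure (D.KvAt x hx))) (D.localToGF_injective_at x hx)
    (D.isOpen_PiXarrow_of_mergeInputs CG hA B I) x (D.localDataOfBadPairs_H_at CG hS M hA hI B ΛBad x hx hxb) n hn

end AtTerm

end InitialThetaData

end Literature.IUT.HodgeTheaters

end
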